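import Literature.NumberTheory.LFunctions.Polymath15RtnEstimate
import Literature.NumberTheory.LFunctions.ConreyAuxiliaryQ
import Literature.NumberTheory.LFunctions.DeBruijnHXiHeatRay
import HarnessLib

/-!
# Polymath 15, §4: the heat-flowed Riemann–Siegel expansion of `H_t` (eq. (htz-expand))

[cite: Polymath2019, §4, eqs. (htz), (37), (ron-def), (htz-expand)]

D.H.J. Polymath, *Effective approximation of heat flow evolution of the Riemann ξ function, and a
new upper bound for the de Bruijn–Newman constant*, Res. Math. Sci. 6 (2019), arXiv:1904.12438, §4.

We follow the printed argument.  From `H_t(z) = ∫_ℝ (1/8) ξ((1+iz)/2 + √t v) (1/√π) e^{-v²} dv`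
(eq. (htz); tree: `Literature.NumberTheory.LFunctions.deBruijnH_eq_integral_riemannXi`) and the
Riemann–Siegel integral formula for `ξ` (eq. (37), obtained from the tree's
`Literature.NumberTheory.LFunctions.SiegelIntegral.riemannZeta_eq_riemannAux_add` by multiplying
with `(1/8)(s(s-1)/2) π^{-s/2} Γ(s/2)`, continued off the real axis by the identity theorem, and
shifting the line of integration past the first `N` poles with
`Literature.NumberTheory.LFunctions.SiegelIntegral.riemannAux_eq_sum_add_rsLineIntegral`), one gets
for every `t > 0`, `N ≥ 0` and `Re z ≠ 0` the expansion (htz-expand)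
`H_t(z) = Σ_{n=1}^N r_{t,n}((1+iz)/2) + Σ_{n=1}^N r*_{t,n}((1-iz)/2) + R_{t,N}((1+iz)/2) + R*_{t,N}((1-iz)/2)`,
`F*(s) := conj F(conj s)`, where `r_{t,n}`, `R_{t,N}` are the Gaussian averages (heat flow) of
`r_{0,n}`, `R_{0,N}` along the horizontal variable.  Interchanging the Gaussian average with the
finite sum requires the integrability of every piece on the line `Im s = Re z / 2 ≠ 0`; this is the
only analytic input beyond the cited tree results, and we prove it from the complex Stirling
formula (`Literature.Analysis.SpecialFunctions.GammaStirling.exists_Gamma_eq_exp_stirling`: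
`|Γ(σ+iτ)| ≤ B_ε e^{ε σ²}` on a fixed horizontal line) and the Gaussian decay of the
Riemann–Siegel kernel (`…SiegelIntegral.norm_rsKernel_line_le`:
`|∫_{c↙} w^{-s} e^{iπw²}/(e^{iπw}-e^{-iπw}) dw| ≤ B_ε e^{ε (Re s)²}`).

Main result: `Literature.NumberTheory.LFunctions.Polymath15.heat_rs_expansion` (statement E0 of the
cell's typed split of Theorem 1.3, with `R0`, `Rt`, `refl` as typed there).
-/

noncomputable section

open Complex MeasureTheory Set Filter Topology

open scoped Real ComplexConjugate

namespace Literature.NumberTheory.LFunctions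

namespace Polymath15

open SiegelIntegral

/-! ## The objects `R_{0,N}`, `R_{t,N}`, `F ↦ F*` -/

/-- `R_{0,N}(s) = (1/8)(s(s−1)/2) π^{−s/2} Γ(s/2) · ∫_{N ↖ N+1} w^{−s}e^{iπw²}/(e^{πiw}−e^{−πiw}) dw`,
the line taken through `N + 1/2`. [cite: Polymath2019, §4 eq. (ron-def)] -/
def R0 (N : ℕ) (s : ℂ) : ℂ := xiFactor s * SiegelIntegral.rsLineIntegral (N + 1 / 2) s

/-- `R_{t,N}(s) = ∫_ℝ R_{0,N}(s + √t v) (1/√π) e^{−v²} dv`.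
[cite: Polymath2019, §4, display after eq. (htz-expand)] -/
def Rt (t : ℝ) (N : ℕ) : ℂ → ℂ := heatAvg t (R0 N)

/-- `F*(s) := conj (F (conj s))` (the paper's `\overline{F}`). [cite: Polymath2019, §4 eq. (37)] -/
def refl (F : ℂ → ℂ) (s : ℂ) : ℂ := conj (F (conj s))

/-- `R_{0,0}(s) = (1/8)(s(s−1)/2) π^{−s/2} Γ(s/2) 𝓡(s)` (the unshifted line through `1/2`).
[cite: Polymath2019, §4 eq. (37)] -/
theorem R0_zero (s : ℂ) : R0 0 s = xiFactor s * riemannAux s := by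
  simp [R0, riemannAux]

/-- `(1/8)(s(s−1)/2) π^{−s/2} Γ(s/2) = (1/8)(s(s−1)/2) Γ_ℝ(s)`. [cite: Polymath2019, §4 eq. (37)] -/
theorem xiFactor_eq_Gammaℝ (s : ℂ) : xiFactor s = 1 / 8 * (s * (s - 1) / 2) * Gammaℝ s := by
  rw [xiFactor, Gammaℝ_def]; ring

/-- The `ξ`-prefactor is real on the real axis: `conj` commutes with it.
[cite: Polymath2019, §4, after eq. (37)] -/
theorem xiFactor_conj (s : ℂ) : xiFactor (conj s) = conj (xiFactor s) := by
  rw [xiFactor_eq_Gammaℝ, xiFactor_eq_Gammaℝ, Gammaℝ_conj]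
  simp [map_ofNat]

/-- `r_{0,n}` is real on the real axis: `r*_{0,n} = r_{0,n}`.
[cite: Polymath2019, §4, after eq. (37)] -/
theorem refl_r0 (n : ℕ) (s : ℂ) : refl (r0 n) s = r0 n s := by
  have harg : ((n : ℂ)).arg ≠ π := by
    rw [show ((n : ℂ)) = ((n : ℝ) : ℂ) by simp, Complex.arg_ofReal_of_nonneg (Nat.cast_nonneg n)]
    exact Real.pi_ne_zero.symm
  rw [refl, r0, r0, map_mul, ← xiFactor_conj, Complex.conj_conj]
  congr 1
  rw [← map_neg, ← Complex.conj_cpow _ _ harg, Complex.conj_natCast]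

/-- `(R_{0,0})*(1 − s) = (1/8)(s(s−1)/2) Γ_ℝ(1−s) · conj 𝓡(1 − conj s)`.
[cite: Polymath2019, §4 eq. (37)] -/
theorem refl_R0_zero_one_sub (s : ℂ) :
    refl (R0 0) (1 - s) = xiFactor (1 - s) * riemannAuxConj s := by
  rw [refl, R0_zero, map_mul, ← xiFactor_conj, riemannAuxConj]
  simp

/-! ## The Riemann–Siegel formula for `ξ` off the real axis (eq. (37), `N = 0`) -/

/-- On `0 < Re s < 3`, `s ≠ 1`: `Λ(s) = Γ_ℝ(s) 𝓡(s) + Γ_ℝ(1−s) conj 𝓡(1 − conj s)` (the symmetric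
form of the Riemann–Siegel integral formula). [cite: Polymath2019, §4 eq. (37)] -/
theorem completedRiemannZeta_eq_rs {s : ℂ} (hs0 : 0 < s.re) (hs3 : s.re < 3) (hs1 : s ≠ 1) :
    completedRiemannZeta s = Gammaℝ s * riemannAux s + Gammaℝ (1 - s) * riemannAuxConj s := by
  have hs : s ≠ 0 := fun h ↦ by rw [h] at hs0; simp at hs0
  have hG : Gammaℝ s ≠ 0 := Gammaℝ_ne_zero_of_re_pos hs0
  have hζ := riemannZeta_def_of_ne_zero hs
  rw [SiegelIntegral.riemannZeta_eq_riemannAux_add hs0 hs3 hs1, eq_div_iff hG] at hζ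
  rw [← hζ, ← Gammaℝ_mul_rsChi hs0]
  ring

/-- `(1/8)(s(s−1)/2) π^{−s/2} Γ(s/2)` is holomorphic off the real axis.
[cite: Polymath2019, §4, "meromorphic functions" after eq. (ron-def)] -/
theorem differentiableAt_xiFactor {s : ℂ} (hs : s.im ≠ 0) : DifferentiableAt ℂ xiFactor s := by
  have hπ : (π : ℂ) ≠ 0 := by exact_mod_cast Real.pi_ne_zero
  have hΓ : DifferentiableAt ℂ (fun z : ℂ ↦ Complex.Gamma (z / 2)) s := by
    refine (Complex.differentiableAt_Gamma _ fun m h ↦ ?_).comp s (differentiableAt_id.div_const 2)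
    have := congrArg Complex.im h
    simp at this
    exact hs this
  have h1 : DifferentiableAt ℂ (fun z : ℂ ↦ (π : ℂ) ^ (-z / 2)) s :=
    ((differentiableAt_id.neg).div_const 2).const_cpow (Or.inl hπ)
  have h3 : DifferentiableAt ℂ (fun z : ℂ ↦ 1 / 8 * (z * (z - 1) / 2)) s := by fun_prop
  exact (h3.mul h1).mul hΓ

/-- The analytic-continuation step: on an open connected `U` off the real axis meeting the strip
`0 < Re s < 3`, `ξ(s)/8 = (1/8)(s(s−1)/2)(Γ_ℝ(s)𝓡(s) + Γ_ℝ(1−s) conj 𝓡(1− conj s))`. [folklore] -/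
private theorem xi_rs_eqOn {U : Set ℂ} (hUo : IsOpen U) (hUc : IsPreconnected U)
    (hU : ∀ w ∈ U, w.im ≠ 0) {z₀ : ℂ} (hz₀ : z₀ ∈ U) (hz₀' : 0 < z₀.re ∧ z₀.re < 3) :
    EqOn (fun w ↦ riemannXi w / 8 - (xiFactor w * riemannAux w + xiFactor (1 - w) * riemannAuxConj w))
      0 U := by
  set g : ℂ → ℂ := fun w ↦
    riemannXi w / 8 - (xiFactor w * riemannAux w + xiFactor (1 - w) * riemannAuxConj w) with hg
  have hdiff : DifferentiableOn ℂ g U := fun w hw ↦ by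
    have hw := hU w hw
    have hw' : (1 - w).im ≠ 0 := by simpa using hw
    have h1 : DifferentiableAt ℂ (fun w : ℂ ↦ xiFactor (1 - w)) w :=
      (differentiableAt_xiFactor hw').comp w ((differentiableAt_const _).sub differentiableAt_id)
    exact (((differentiable_riemannXi w).div_const 8).sub
      (((differentiableAt_xiFactor hw).mul (differentiable_riemannAux w)).add
        (h1.mul (differentiable_riemannAuxConj w)))).differentiableWithinAt
  have han : AnalyticOnNhd ℂ g U := hdiff.analyticOnNhd hUo
  -- `g = 0` on the open set `U ∩ {0 < Re < 3}` containing `z₀`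
  have hV : ∀ w ∈ U ∩ {w : ℂ | 0 < w.re ∧ w.re < 3}, g w = 0 := by
    rintro w ⟨hwU, hw0, hw3⟩
    have hw := hU w hwU
    have hw1 : w ≠ 1 := fun h ↦ by rw [h] at hw; simp at hw
    have hw0' : w ≠ 0 := fun h ↦ by rw [h] at hw; simp at hw
    simp only [hg, riemannXi_eq_mul_completedRiemannZeta hw0' hw1, completedRiemannZeta_eq_rs hw0 hw3 hw1,
      xiFactor_eq_Gammaℝ]
    ring
  have hev : g =ᶠ[𝓝 z₀] 0 := by
    have hopen : IsOpen (U ∩ {w : ℂ | 0 < w.re ∧ w.re < 3}) := by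
      refine hUo.inter ?_
      have : {w : ℂ | 0 < w.re ∧ w.re < 3} = (Complex.re ⁻¹' Ioo 0 3) := by
        ext w; simp
      rw [this]
      exact isOpen_Ioo.preimage Complex.continuous_re
    filter_upwards [hopen.mem_nhds ⟨hz₀, hz₀'⟩] with w hw using hV w hw
  exact han.eqOn_zero_of_preconnected_of_eventuallyEq_zero hUc hz₀ hev

/-- **Riemann–Siegel formula for `ξ` off the real axis** (eq. (37) with `N = 0`): for `Im s ≠ 0`,
`ξ(s)/8 = R_{0,0}(s) + (R_{0,0})*(1 − s)`. [cite: Polymath2019, §4 eq. (37)] -/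
theorem riemannXi_div_eight_eq {s : ℂ} (hs : s.im ≠ 0) :
    riemannXi s / 8 = R0 0 s + refl (R0 0) (1 - s) := by
  rw [R0_zero, refl_R0_zero_one_sub]
  rcases lt_or_gt_of_ne hs with h | h
  · have key := xi_rs_eqOn (U := {w : ℂ | w.im < 0}) (z₀ := 2 - I)
      (isOpen_lt Complex.continuous_im continuous_const) (convex_halfSpace_im_lt 0).isPreconnected
      (fun w hw ↦ ne_of_lt hw) (by simp) (by simp; norm_num) h
    simpa [sub_eq_zero] using key
  · have key := xi_rs_eqOn (U := {w : ℂ | 0 < w.im}) (z₀ := 2 + I)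
      (isOpen_lt continuous_const Complex.continuous_im) (convex_halfSpace_im_gt 0).isPreconnected
      (fun w hw ↦ ne_of_gt hw) (by simp) (by simp; norm_num) h
    simpa [sub_eq_zero] using key

/-! ## Shifting the line past the first `N` poles (eq. (37) for general `N`) -/

/-- `R_{0,0}(s) = Σ_{n=1}^N r_{0,n}(s) + R_{0,N}(s)` (residue theorem, tree:
`…SiegelIntegral.riemannAux_eq_sum_add_rsLineIntegral`). [cite: Polymath2019, §4 eq. (37)] -/
theorem R0_zero_eq_sum_add (N : ℕ) (s : ℂ) :
    R0 0 s = ∑ n ∈ Finset.Icc 1 N, r0 n s + R0 N s := by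
  rcases Nat.eq_zero_or_pos N with hN | hN
  · subst hN; simp
  · rw [R0_zero, SiegelIntegral.riemannAux_eq_sum_add_rsLineIntegral s hN (c := N + 1 / 2)
      (by linarith) (by linarith), mul_add, Finset.mul_sum, R0]
    rfl

/-- The reflected expansion `(R_{0,0})*(w) = Σ_{n=1}^N (r_{0,n})*(w) + (R_{0,N})*(w)`.
[cite: Polymath2019, §4 eq. (37)] -/
theorem refl_R0_zero_eq_sum_add (N : ℕ) (w : ℂ) :
    refl (R0 0) w = ∑ n ∈ Finset.Icc 1 N, refl (r0 n) w + refl (R0 N) w := by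
  simp only [refl, R0_zero_eq_sum_add N (conj w), map_add, map_sum]

/-! ## Heat-flow bookkeeping -/

variable {t : ℝ}

/-- The Gaussian weight `(1/√π) e^{−v²}` as a complex number. [folklore] -/
private theorem gaussW_def (v : ℝ) :
    ((Real.exp (-v ^ 2) / Real.sqrt π : ℝ) : ℂ) = ((Real.exp (-v ^ 2) / Real.sqrt π : ℝ) : ℂ) := rfl

/-- The heat flow only sees the line `Im = Im s`. [cite: Polymath2019, §4, definition of r_{t,n}] -/
theorem heatAvg_congr_im {F G : ℂ → ℂ} {s : ℂ} (h : ∀ w : ℂ, w.im = s.im → F w = G w) :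
    heatAvg t F s = heatAvg t G s := by
  unfold heatAvg
  congr 1; ext v
  rw [h _ (by simp)]

/-- Additivity of the heat flow (given integrability). [cite: Polymath2019, §4 eq. (htz-expand)] -/
theorem heatAvg_add {F G : ℂ → ℂ} {s : ℂ}
    (hF : Integrable fun v : ℝ ↦ ((Real.exp (-v ^ 2) / Real.sqrt π : ℝ) : ℂ) * F (s + Real.sqrt t * v))
    (hG : Integrable fun v : ℝ ↦ ((Real.exp (-v ^ 2) / Real.sqrt π : ℝ) : ℂ) * G (s + Real.sqrt t * v)) :
    heatAvg t (fun w ↦ F w + G w) s = heatAvg t F s + heatAvg t G s := by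
  unfold heatAvg
  rw [← integral_add hF hG]
  congr 1; ext v; ring

/-- Finite additivity of the heat flow (given integrability). [cite: Polymath2019, §4 eq. (htz-expand)] -/
theorem heatAvg_finset_sum {ι : Type*} (S : Finset ι) {F : ι → ℂ → ℂ} {s : ℂ}
    (hF : ∀ i ∈ S, Integrable fun v : ℝ ↦
      ((Real.exp (-v ^ 2) / Real.sqrt π : ℝ) : ℂ) * F i (s + Real.sqrt t * v)) :
    heatAvg t (fun w ↦ ∑ i ∈ S, F i w) s = ∑ i ∈ S, heatAvg t (F i) s := by
  unfold heatAvg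
  rw [← integral_finsetSum S hF]
  congr 1; ext v
  rw [Finset.mul_sum]

/-- The heat flow commutes with `F ↦ F*(1 − ·)`:
`∫ (F*)(1 − s − √t v) (1/√π)e^{−v²} dv = (heat flow of F)*(1 − s)` (substitute `v ↦ −v`).
[cite: Polymath2019, §4 eq. (htz-expand)] -/
theorem heatAvg_refl_one_sub (F : ℂ → ℂ) (s : ℂ) :
    heatAvg t (fun w ↦ refl F (1 - w)) s = refl (heatAvg t F) (1 - s) := by
  unfold heatAvg refl
  rw [← integral_conj, ← integral_neg_eq_self]
  congr 1; ext v
  simp only [map_mul, Complex.conj_ofReal, map_add, map_sub, map_one]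
  push_cast
  ring_nf


/-! ## Growth on a fixed horizontal line: sub-Gaussian bounds

The interchange of the Gaussian average with the Riemann–Siegel expansion needs every piece to be
integrable against `e^{-v²}` on the line `Im s = Re z/2`; we show the stronger bounds
`|Γ(σ+iτ)|, |∫_{c↙} …| ≤ B_ε e^{ε σ²}` for every `ε > 0`. -/

section Growth

/-- AM–GM: `a|x| ≤ ε x² + a²/(4ε)`. [folklore] -/
private theorem mul_abs_le_sq {ε : ℝ} (hε : 0 < ε) (a x : ℝ) :
    a * |x| ≤ ε * x ^ 2 + a ^ 2 / (4 * ε) := by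
  rw [← sq_abs x]
  have h4 : (0 : ℝ) < 4 * ε := by positivity
  have key : (2 * ε * |x| - a) ^ 2 / (4 * ε) = ε * |x| ^ 2 + a ^ 2 / (4 * ε) - a * |x| := by
    field_simp
    ring
  have h0 : 0 ≤ (2 * ε * |x| - a) ^ 2 / (4 * ε) := by positivity
  linarith

/-- `log x ≤ δ x − 1 − log δ` (`x, δ > 0`). [folklore] -/
private theorem log_le_mul_sub {δ x : ℝ} (hδ : 0 < δ) (hx : 0 < x) :
    Real.log x ≤ δ * x - 1 - Real.log δ := by
  have h := Real.log_le_sub_one_of_pos (mul_pos hδ hx)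
  rw [Real.log_mul hδ.ne' hx.ne'] at h
  linarith

/-- `x² ≤ e^{δ x²}/δ`. [folklore] -/
private theorem sq_le_exp_div {δ : ℝ} (hδ : 0 < δ) (x : ℝ) : x ^ 2 ≤ Real.exp (δ * x ^ 2) / δ := by
  rw [le_div_iff₀ hδ]
  have := Real.add_one_le_exp (δ * x ^ 2)
  nlinarith

/-- Real part of the Stirling exponent on the line `Im z = τ > 0`:
`Re((z − ½) Log z − z + E) ≤ (σ − ½) log|z| − σ + |E|` (drop `−τ arg z ≤ 0`). [folklore] -/
private theorem stirling_re_le {σ τ : ℝ} (hτ : 0 < τ) (E : ℂ) :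
    ((((σ : ℂ) + τ * I) - 1 / 2) * Complex.log ((σ : ℂ) + τ * I) - ((σ : ℂ) + τ * I) + E).re
      ≤ (σ - 1 / 2) * Real.log ‖(σ : ℂ) + τ * I‖ - σ + ‖E‖ := by
  have hz' : ((σ : ℂ) + τ * I) - 1 / 2 = ((σ - 1 / 2 : ℝ) : ℂ) + τ * I := by push_cast; ring
  have h1 : ((((σ : ℂ) + τ * I) - 1 / 2) * Complex.log ((σ : ℂ) + τ * I)).re
      = (σ - 1 / 2) * Real.log ‖(σ : ℂ) + τ * I‖ - τ * Complex.arg ((σ : ℂ) + τ * I) := by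
    rw [Complex.mul_re, Complex.log_re, Complex.log_im, hz']
    simp
  have harg : 0 ≤ Complex.arg ((σ : ℂ) + τ * I) := Complex.arg_nonneg_iff.2 (by simp [hτ.le])
  have hE : E.re ≤ ‖E‖ := Complex.re_le_norm E
  rw [Complex.add_re, Complex.sub_re, h1]
  simp only [Complex.add_re, Complex.ofReal_re, Complex.mul_re, Complex.I_re, mul_zero,
    Complex.ofReal_im, Complex.I_im, mul_one, sub_self, add_zero]
  nlinarith [mul_nonneg hτ.le harg]

/-- If `log τ ≤ ℓ ≤ δ|σ| + D` then `(σ − ½) ℓ ≤ δ σ² + (|σ| + ½)(|D| + |log τ|)`. [folklore] -/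
private theorem half_log_bound {σ τ δ ℓ D : ℝ} (hδ : 0 < δ) (hlo : Real.log τ ≤ ℓ)
    (hhi : ℓ ≤ δ * |σ| + D) :
    (σ - 1 / 2) * ℓ ≤ δ * σ ^ 2 + (|σ| + 1 / 2) * (|D| + |Real.log τ|) := by
  have hσabs : σ * |σ| ≤ σ ^ 2 := by
    rcases le_or_gt 0 σ with h | h
    · rw [abs_of_nonneg h]; nlinarith
    · rw [abs_of_neg h]; nlinarith
  have hhalf : |σ - 1 / 2| ≤ |σ| + 1 / 2 :=
    abs_le.2 ⟨by linarith [neg_abs_le σ], by linarith [le_abs_self σ]⟩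
  have hX : (σ - 1 / 2) * D ≤ (|σ| + 1 / 2) * |D| :=
    calc (σ - 1 / 2) * D ≤ |(σ - 1 / 2) * D| := le_abs_self _
      _ = |σ - 1 / 2| * |D| := abs_mul _ _
      _ ≤ (|σ| + 1 / 2) * |D| := by gcongr
  have hY : (σ - 1 / 2) * Real.log τ ≤ (|σ| + 1 / 2) * |Real.log τ| :=
    calc (σ - 1 / 2) * Real.log τ ≤ |(σ - 1 / 2) * Real.log τ| := le_abs_self _
      _ = |σ - 1 / 2| * |Real.log τ| := abs_mul _ _
      _ ≤ (|σ| + 1 / 2) * |Real.log τ| := by gcongr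
  have hpos1 : 0 ≤ (|σ| + 1 / 2) * |D| := by positivity
  have hpos2 : 0 ≤ (|σ| + 1 / 2) * |Real.log τ| := by positivity
  have hpos3 : 0 ≤ δ / 2 * |σ| := by positivity
  have hpos4 : 0 ≤ δ * σ ^ 2 := by positivity
  rcases le_or_gt 0 (σ - 1 / 2) with h | h
  · have h1 : (σ - 1 / 2) * ℓ ≤ (σ - 1 / 2) * (δ * |σ| + D) := mul_le_mul_of_nonneg_left hhi h
    have h2 : (σ - 1 / 2) * (δ * |σ| + D) = δ * (σ * |σ|) - δ / 2 * |σ| + (σ - 1 / 2) * D := by ring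
    have h3 := mul_le_mul_of_nonneg_left hσabs hδ.le
    nlinarith
  · have h1 : (σ - 1 / 2) * ℓ ≤ (σ - 1 / 2) * Real.log τ := mul_le_mul_of_nonpos_left hlo h.le
    nlinarith

/-- Stirling in the upper half-plane gives `|Γ(σ+iτ)| ≤ B e^{ε σ²}` on the line `τ > 0`.
[cite: Polymath2019, Lemma 5.1 (v)] -/
private theorem exists_norm_Gamma_line_le_of_pos {τ : ℝ} (hτ : 0 < τ) {ε : ℝ} (hε : 0 < ε) :
    ∃ B : ℝ, 0 < B ∧ ∀ σ : ℝ, ‖Complex.Gamma (σ + τ * I)‖ ≤ B * Real.exp (ε * σ ^ 2) := by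
  have hδ0 : 0 < ε / 2 := by positivity
  -- constants
  obtain ⟨D, hD⟩ : ∃ D : ℝ, D = ε / 2 * τ - 1 - Real.log (ε / 2) := ⟨_, rfl⟩
  obtain ⟨K, hK⟩ : ∃ K : ℝ, K = |D| + |Real.log τ| := ⟨_, rfl⟩
  have hK0 : 0 ≤ K := by rw [hK]; positivity
  obtain ⟨C₁, hC₁⟩ : ∃ C₁ : ℝ, C₁ = 1 / (12 * τ) + (π + 1) / (16 * π * τ ^ 2) := ⟨_, rfl⟩
  obtain ⟨C, hC⟩ : ∃ C : ℝ, C = K / 2 + (K + 1) ^ 2 / (4 * (ε / 2)) + C₁ := ⟨_, rfl⟩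
  refine ⟨Real.sqrt (2 * π) * Real.exp C, by positivity, fun σ ↦ ?_⟩
  have hz0 : 0 < ((σ : ℂ) + τ * I).im := by simp [hτ]
  obtain ⟨E, hE, hΓ⟩ :=
    Literature.Analysis.SpecialFunctions.GammaStirling.exists_Gamma_eq_exp_stirling hz0
  -- size of `z`
  have hnz : τ ≤ ‖(σ : ℂ) + τ * I‖ := by
    have := Complex.abs_im_le_norm ((σ : ℂ) + τ * I)
    simpa [abs_of_pos hτ] using this
  have hnz' : ‖(σ : ℂ) + τ * I‖ ≤ |σ| + τ := by
    have := Complex.norm_le_abs_re_add_abs_im ((σ : ℂ) + τ * I)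
    simpa [abs_of_pos hτ] using this
  have hnz0 : 0 < ‖(σ : ℂ) + τ * I‖ := lt_of_lt_of_le hτ hnz
  -- the error term
  have hE' : ‖E‖ ≤ C₁ := by
    refine hE.trans ?_
    rw [hC₁]
    have him : ((σ : ℂ) + τ * I).im = τ := by simp
    rw [him]
    gcongr
  -- the logarithm
  have hℓ_lo : Real.log τ ≤ Real.log ‖(σ : ℂ) + τ * I‖ := Real.log_le_log hτ hnz
  have hℓ_hi : Real.log ‖(σ : ℂ) + τ * I‖ ≤ ε / 2 * |σ| + D := by
    have h1 : Real.log ‖(σ : ℂ) + τ * I‖ ≤ Real.log (|σ| + τ) := Real.log_le_log hnz0 hnz'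
    have h2 := log_le_mul_sub hδ0 (show 0 < |σ| + τ by positivity)
    rw [hD]; linarith
  have hmain := half_log_bound hδ0 hℓ_lo hℓ_hi
  rw [← hK] at hmain
  have hre := stirling_re_le hτ E (σ := σ)
  have hlin : (K + 1) * |σ| ≤ ε / 2 * σ ^ 2 + (K + 1) ^ 2 / (4 * (ε / 2)) := mul_abs_le_sq hδ0 _ σ
  have hσ : -σ ≤ |σ| := neg_le_abs σ
  have htot : ((((σ : ℂ) + τ * I) - 1 / 2) * Complex.log ((σ : ℂ) + τ * I) - ((σ : ℂ) + τ * I) + E).re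
      ≤ ε * σ ^ 2 + C := by
    rw [hC]
    have : (|σ| + 1 / 2) * K - σ ≤ (K + 1) * |σ| + K / 2 := by nlinarith
    linarith
  rw [hΓ, norm_mul, Complex.norm_real, Real.norm_of_nonneg (Real.sqrt_nonneg _), Complex.norm_exp,
    mul_assoc, ← Real.exp_add]
  gcongr
  linarith

/-- **Sub-Gaussian growth of `Γ` on a horizontal line**: for `τ ≠ 0` and `ε > 0` there is `B` with
`|Γ(σ + iτ)| ≤ B e^{ε σ²}` for all real `σ` (from the complex Stirling formula, Lemma 5.1 (v); the
lower half-plane by `Γ(conj z) = conj Γ(z)`). [cite: Polymath2019, Lemma 5.1 (v)] -/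
theorem exists_norm_Gamma_line_le {τ : ℝ} (hτ : τ ≠ 0) {ε : ℝ} (hε : 0 < ε) :
    ∃ B : ℝ, 0 < B ∧ ∀ σ : ℝ, ‖Complex.Gamma (σ + τ * I)‖ ≤ B * Real.exp (ε * σ ^ 2) := by
  rcases lt_or_gt_of_ne hτ with h | h
  · obtain ⟨B, hB, hle⟩ := exists_norm_Gamma_line_le_of_pos (neg_pos.2 h) hε
    refine ⟨B, hB, fun σ ↦ ?_⟩
    have : (σ : ℂ) + τ * I = conj ((σ : ℂ) + (-τ : ℝ) * I) := by
      apply Complex.ext <;> simp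
    rw [this, Complex.Gamma_conj, Complex.norm_conj]
    exact hle σ
  · exact exists_norm_Gamma_line_le_of_pos h hε

/-- The polynomial factor: `|s(s−1)/2| ≤ ((2/δ + 2c²)/2) e^{δσ²}`, `c = 1 + |τ|`. [folklore] -/
private theorem norm_poly_le {δ : ℝ} (hδ : 0 < δ) (σ τ : ℝ) :
    ‖((σ : ℂ) + τ * I) * (((σ : ℂ) + τ * I) - 1) / 2‖
      ≤ (2 / δ + 2 * (1 + |τ|) ^ 2) * Real.exp (δ * σ ^ 2) / 2 := by
  rw [norm_div, Complex.norm_ofNat, norm_mul]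
  have h1 : ‖(σ : ℂ) + τ * I‖ ≤ |σ| + (1 + |τ|) := by
    refine (Complex.norm_le_abs_re_add_abs_im _).trans ?_
    simp
  have h2 : ‖(σ : ℂ) + τ * I - 1‖ ≤ |σ| + (1 + |τ|) := by
    refine (Complex.norm_le_abs_re_add_abs_im _).trans ?_
    have hre : ((σ : ℂ) + τ * I - 1).re = σ - 1 := by simp
    have him : ((σ : ℂ) + τ * I - 1).im = τ := by simp
    rw [hre, him]
    have : |σ - 1| ≤ |σ| + 1 := abs_le.2 ⟨by linarith [neg_abs_le σ], by linarith [le_abs_self σ]⟩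
    linarith
  have h4 : (|σ| + (1 + |τ|)) ^ 2 ≤ 2 * σ ^ 2 + 2 * (1 + |τ|) ^ 2 := by
    nlinarith [sq_nonneg (|σ| - (1 + |τ|)), sq_abs σ]
  have h5 := sq_le_exp_div hδ σ
  have h6 : 1 ≤ Real.exp (δ * σ ^ 2) := Real.one_le_exp (by positivity)
  have h7 : 0 ≤ (1 + |τ|) ^ 2 := sq_nonneg _
  have h3 : (|σ| + (1 + |τ|)) ^ 2 ≤ (2 / δ + 2 * (1 + |τ|) ^ 2) * Real.exp (δ * σ ^ 2) := by
    have : (2 / δ + 2 * (1 + |τ|) ^ 2) * Real.exp (δ * σ ^ 2)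
        = 2 * (Real.exp (δ * σ ^ 2) / δ) + 2 * (1 + |τ|) ^ 2 * Real.exp (δ * σ ^ 2) := by ring
    rw [this]
    nlinarith
  gcongr ?_ / 2
  calc ‖(σ : ℂ) + τ * I‖ * ‖(σ : ℂ) + τ * I - 1‖ ≤ (|σ| + (1 + |τ|)) * (|σ| + (1 + |τ|)) := by
        gcongr
    _ = (|σ| + (1 + |τ|)) ^ 2 := by ring
    _ ≤ _ := h3

/-- The power of `π`: `|π^{−s/2}| ≤ e^{δσ²} e^{(log π/2)²/(4δ)}`. [folklore] -/
private theorem norm_pi_cpow_le {δ : ℝ} (hδ : 0 < δ) (σ τ : ℝ) :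
    ‖(π : ℂ) ^ (-((σ : ℂ) + τ * I) / 2)‖
      ≤ Real.exp (δ * σ ^ 2) * Real.exp ((Real.log π / 2) ^ 2 / (4 * δ)) := by
  have hπ : (0 : ℝ) < π := Real.pi_pos
  rw [Complex.norm_cpow_eq_rpow_re_of_pos hπ, Real.rpow_def_of_pos hπ, ← Real.exp_add]
  have : (-((σ : ℂ) + τ * I) / 2).re = -σ / 2 := by simp
  rw [this]
  gcongr
  have h1 := mul_abs_le_sq hδ (Real.log π / 2) σ
  have hlπ : 0 ≤ Real.log π := Real.log_nonneg (by linarith [Real.pi_gt_three])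
  have h2 : Real.log π * (-σ / 2) ≤ Real.log π / 2 * |σ| := by
    have := neg_abs_le σ
    nlinarith
  linarith

/-- **Sub-Gaussian growth of the `ξ`-prefactor**: for `τ ≠ 0`, `ε > 0` there is `B` with
`|(1/8)(s(s−1)/2) π^{−s/2} Γ(s/2)| ≤ B e^{ε σ²}`, `s = σ + iτ`. [cite: Polymath2019, Lemma 5.1 (v)] -/
theorem exists_norm_xiFactor_line_le {τ : ℝ} (hτ : τ ≠ 0) {ε : ℝ} (hε : 0 < ε) :
    ∃ B : ℝ, 0 < B ∧ ∀ σ : ℝ, ‖xiFactor (σ + τ * I)‖ ≤ B * Real.exp (ε * σ ^ 2) := by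
  have hδ0 : 0 < ε / 4 := by positivity
  obtain ⟨B₁, hB₁, hΓ⟩ := exists_norm_Gamma_line_le (τ := τ / 2) (by positivity) hε
  refine ⟨1 / 8 * ((2 / (ε / 4) + 2 * (1 + |τ|) ^ 2) / 2) *
      Real.exp ((Real.log π / 2) ^ 2 / (4 * (ε / 4))) * B₁, by positivity, fun σ ↦ ?_⟩
  have hpoly := norm_poly_le hδ0 σ τ
  have hpow := norm_pi_cpow_le hδ0 σ τ
  have hG : ‖Complex.Gamma (((σ : ℂ) + τ * I) / 2)‖ ≤ B₁ * Real.exp (ε * (σ / 2) ^ 2) := by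
    have : ((σ : ℂ) + τ * I) / 2 = ((σ / 2 : ℝ) : ℂ) + ((τ / 2 : ℝ) : ℂ) * I := by
      push_cast; ring
    rw [this]
    exact hΓ (σ / 2)
  rw [xiFactor, norm_mul, norm_mul, norm_mul]
  calc ‖(1 / 8 : ℂ)‖ * ‖((σ : ℂ) + τ * I) * (((σ : ℂ) + τ * I) - 1) / 2‖ *
        ‖(π : ℂ) ^ (-((σ : ℂ) + τ * I) / 2)‖ * ‖Complex.Gamma (((σ : ℂ) + τ * I) / 2)‖
      ≤ (1 / 8) * ((2 / (ε / 4) + 2 * (1 + |τ|) ^ 2) * Real.exp (ε / 4 * σ ^ 2) / 2) *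
          (Real.exp (ε / 4 * σ ^ 2) * Real.exp ((Real.log π / 2) ^ 2 / (4 * (ε / 4)))) *
          (B₁ * Real.exp (ε * (σ / 2) ^ 2)) := by
        gcongr
        norm_num
    _ = 1 / 8 * ((2 / (ε / 4) + 2 * (1 + |τ|) ^ 2) / 2) *
          Real.exp ((Real.log π / 2) ^ 2 / (4 * (ε / 4))) * B₁ *
          Real.exp (ε / 4 * σ ^ 2 + ε / 4 * σ ^ 2 + ε * (σ / 2) ^ 2) := by
        rw [Real.exp_add, Real.exp_add]; ring
    _ ≤ 1 / 8 * ((2 / (ε / 4) + 2 * (1 + |τ|) ^ 2) / 2) *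
          Real.exp ((Real.log π / 2) ^ 2 / (4 * (ε / 4))) * B₁ * Real.exp (ε * σ ^ 2) := by
        gcongr
        nlinarith [sq_nonneg σ]

/-- Pointwise majorant for the moment integrand of the Riemann–Siegel kernel:
`(1+|u|)^N e^{−2πu² + βu} ≤ e^{(δN)²/(2π) + N(δ − 1 − log δ) + β²/(2π)} e^{−πu²}`. [folklore] -/
private theorem poly_gauss_le {δ : ℝ} (hδ : 0 < δ) (N : ℕ) (β u : ℝ) :
    (1 + |u|) ^ N * Real.exp (-2 * π * u ^ 2 + β * u + 0)
      ≤ Real.exp ((δ * N) ^ 2 / (2 * π) + N * (δ - 1 - Real.log δ) + β ^ 2 / (2 * π)) *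
        Real.exp (-π * u ^ 2) := by
  have hπ : (0 : ℝ) < π := Real.pi_pos
  have h0 : 0 < 1 + |u| := by positivity
  rw [← Real.exp_log (pow_pos h0 N), Real.log_pow, ← Real.exp_add, ← Real.exp_add]
  refine Real.exp_le_exp.2 ?_
  have h1 := log_le_mul_sub hδ h0
  have h2 : (N : ℝ) * Real.log (1 + |u|) ≤ δ * N * |u| + N * (δ - 1 - Real.log δ) := by
    have := mul_le_mul_of_nonneg_left h1 (Nat.cast_nonneg N)
    linarith
  have h3 := mul_abs_le_sq (show (0:ℝ) < π / 2 by positivity) (δ * N) u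
  have h4 := mul_abs_le_sq (show (0:ℝ) < π / 2 by positivity) |β| u
  have h5 : β * u ≤ |β| * |u| := by rw [← abs_mul]; exact le_abs_self _
  have h6 : (δ * N) ^ 2 / (4 * (π / 2)) = (δ * N) ^ 2 / (2 * π) := by ring
  have h7 : |β| ^ 2 / (4 * (π / 2)) = β ^ 2 / (2 * π) := by rw [sq_abs]; ring
  rw [h6] at h3; rw [h7] at h4
  linarith

/-- `N + 1/2` is not an integer. [folklore] -/
private theorem int_ne_nat_add_half (N : ℕ) (n : ℤ) : (n : ℝ) ≠ N + 1 / 2 := by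
  intro h
  have h2 : ((2 * n : ℤ) : ℝ) = ((2 * N + 1 : ℤ) : ℝ) := by push_cast; linarith
  have h3 : (2 * n : ℤ) = 2 * N + 1 := by exact_mod_cast h2
  omega

/-- Step 1 for the line integral: `|∫_{c↙}| ≤ √2 · M^N e^{π|τ|}/(2d) · e^{A_N}` with
`N = ⌈|σ|⌉`, `M = c + 2/c + 2`, `A_N` the exponent of `poly_gauss_le`. [folklore] -/
private theorem norm_rsLineIntegral_le_step {c d : ℝ} (hc : 0 < c) (hd0 : 0 < d)
    (hd : ∀ n : ℤ, d ≤ |c - n|) {δ : ℝ} (hδ : 0 < δ) (σ τ : ℝ) :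
    ‖rsLineIntegral c (σ + τ * I)‖ ≤ ‖-(1 + I : ℂ)‖ *
      ((|c| + 2 / |c| + 2) ^ ⌈|σ|⌉₊ * Real.exp (π * |τ|) / (2 * d) *
        Real.exp ((δ * ⌈|σ|⌉₊) ^ 2 / (2 * π) + ⌈|σ|⌉₊ * (δ - 1 - Real.log δ) +
          (-2 * π * c) ^ 2 / (2 * π))) := by
  have hπ : (0 : ℝ) < π := Real.pi_pos
  have hNσ : |((σ : ℂ) + τ * I).re| ≤ (⌈|σ|⌉₊ : ℕ) := by simp [Nat.le_ceil]
  have hsim : ((σ : ℂ) + τ * I).im = τ := by simp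
  have hker : ∀ u : ℝ, ‖rsKernel ((σ : ℂ) + τ * I) (line c u)‖ ≤
      (|c| + 2 / |c| + 2) ^ ⌈|σ|⌉₊ * Real.exp (π * |τ|) / (2 * d) *
        (Real.exp ((δ * ⌈|σ|⌉₊) ^ 2 / (2 * π) + ⌈|σ|⌉₊ * (δ - 1 - Real.log δ) +
          (-2 * π * c) ^ 2 / (2 * π)) * Real.exp (-π * u ^ 2)) := fun u ↦ by
    have h1 := norm_rsKernel_line_le hc hd0 hd u ((σ : ℂ) + τ * I) hNσ
    rw [hsim] at h1
    exact h1.trans (mul_le_mul_of_nonneg_left (poly_gauss_le hδ _ _ u) (by positivity))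
  have hmaj : Integrable fun u : ℝ ↦ (|c| + 2 / |c| + 2) ^ ⌈|σ|⌉₊ * Real.exp (π * |τ|) / (2 * d) *
      (Real.exp ((δ * ⌈|σ|⌉₊) ^ 2 / (2 * π) + ⌈|σ|⌉₊ * (δ - 1 - Real.log δ) +
        (-2 * π * c) ^ 2 / (2 * π)) * Real.exp (-π * u ^ 2)) :=
    ((integrable_exp_neg_mul_sq hπ).const_mul _).const_mul _
  rw [rsLineIntegral, norm_mul]
  gcongr
  refine (norm_integral_le_integral_norm _).trans ?_
  refine (integral_mono (integrable_rsKernel_line _ hc hd0 hd).norm hmaj hker).trans (le_of_eq ?_)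
  rw [integral_const_mul, integral_const_mul, integral_gaussian, div_self hπ.ne', Real.sqrt_one,
    mul_one]

/-- Step 2 for the line integral: packaging the exponent. [folklore] -/
private theorem exponent_pack {σ n L K Q ε δ : ℝ} (hn0 : 0 ≤ n) (hn : n ≤ |σ| + 1) (hL : 0 ≤ L)
    (hε : 0 < ε) (hδε : δ ^ 2 ≤ ε) :
    n * L + ((δ * n) ^ 2 / (2 * π) + n * K + Q)
      ≤ ε * σ ^ 2 + ((L + |K| + ε) ^ 2 / (4 * (ε / 2)) + L + |K| + ε + Q) := by
  have hπ3 := Real.pi_gt_three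
  have h1 : n * L ≤ (|σ| + 1) * L := mul_le_mul_of_nonneg_right hn hL
  have h2 : n * K ≤ (|σ| + 1) * |K| :=
    (mul_le_mul_of_nonneg_left (le_abs_self K) hn0).trans
      (mul_le_mul_of_nonneg_right hn (abs_nonneg K))
  have h3 : (δ * n) ^ 2 ≤ ε * (|σ| + 1) ^ 2 := by
    have : n ^ 2 ≤ (|σ| + 1) ^ 2 := by gcongr
    have h' : 0 ≤ δ ^ 2 := sq_nonneg δ
    calc (δ * n) ^ 2 = δ ^ 2 * n ^ 2 := by ring
      _ ≤ ε * (|σ| + 1) ^ 2 := by gcongr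
  have h4 : (δ * n) ^ 2 / (2 * π) ≤ ε / 2 * σ ^ 2 / 2 + ε * |σ| + ε := by
    rw [div_le_iff₀ (by positivity)]
    have hσ2 : (|σ| + 1) ^ 2 = σ ^ 2 + 2 * |σ| + 1 := by rw [add_sq, sq_abs]; ring
    rw [hσ2] at h3
    have hx : 0 ≤ ε * σ ^ 2 := mul_nonneg hε.le (sq_nonneg σ)
    have hy : 0 ≤ ε * |σ| := mul_nonneg hε.le (abs_nonneg σ)
    have hp1 : ε * σ ^ 2 ≤ π / 2 * (ε * σ ^ 2) := by nlinarith
    have hp2 : 2 * (ε * |σ|) ≤ 2 * π * (ε * |σ|) := by nlinarith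
    have hp3 : ε ≤ 2 * π * ε := by nlinarith
    nlinarith
  have h5 := mul_abs_le_sq (show 0 < ε / 2 by positivity) (L + |K| + ε) σ
  nlinarith [abs_nonneg σ, sq_nonneg σ, abs_nonneg K]

/-- **Sub-Gaussian growth of the Riemann–Siegel line integral** in `Re s` on a fixed horizontal
line: for `c > 0` not an integer, `τ` real and `ε > 0` there is `B` with
`|∫_{c↙} w^{-s} e^{iπw²}/(e^{iπw} − e^{−iπw}) dw| ≤ B e^{ε σ²}`, `s = σ + iτ` (from the kernel
bound `|w^{-s}| ≤ C^N (1+|u|)^N e^{π|τ|}`, `N = ⌈|σ|⌉`, and the Gaussian decay `e^{−2πu²}` of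
`e^{iπw²}` on the line). [cite: Polymath2019, §4, convergence of (37)] -/
theorem exists_norm_rsLineIntegral_line_le {c : ℝ} (hc : 0 < c) (hcn : ∀ n : ℤ, (n : ℝ) ≠ c)
    (τ : ℝ) {ε : ℝ} (hε : 0 < ε) :
    ∃ B : ℝ, 0 < B ∧ ∀ σ : ℝ, ‖rsLineIntegral c (σ + τ * I)‖ ≤ B * Real.exp (ε * σ ^ 2) := by
  obtain ⟨d, hd0, hd⟩ := exists_pos_le_abs_sub_int hcn
  have hπ : (0 : ℝ) < π := Real.pi_pos
  have hM1 : 1 ≤ |c| + 2 / |c| + 2 := by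
    have : 0 ≤ 2 / |c| := by positivity
    linarith [abs_nonneg c]
  have hlogM : 0 ≤ Real.log (|c| + 2 / |c| + 2) := Real.log_nonneg hM1
  have hδ0 : 0 < min 1 ε := lt_min one_pos hε
  have hδε : (min 1 ε) ^ 2 ≤ ε := by
    have h1 : min 1 ε ≤ 1 := min_le_left _ _
    have h2 : min 1 ε ≤ ε := min_le_right _ _
    nlinarith
  obtain ⟨L, hL⟩ : ∃ L : ℝ, L = Real.log (|c| + 2 / |c| + 2) := ⟨_, rfl⟩
  obtain ⟨K, hK⟩ : ∃ K : ℝ, K = min 1 ε - 1 - Real.log (min 1 ε) := ⟨_, rfl⟩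
  obtain ⟨Q, hQ⟩ : ∃ Q : ℝ, Q = (-2 * π * c) ^ 2 / (2 * π) := ⟨_, rfl⟩
  obtain ⟨C, hC⟩ : ∃ C : ℝ, C = (L + |K| + ε) ^ 2 / (4 * (ε / 2)) + L + |K| + ε + Q := ⟨_, rfl⟩
  refine ⟨‖-(1 + I : ℂ)‖ * (Real.exp (π * |τ|) / (2 * d) * Real.exp C) + 1, by positivity,
    fun σ ↦ ?_⟩
  have hstep := norm_rsLineIntegral_le_step hc hd0 hd hδ0 σ τ
  rw [← hK, ← hQ] at hstep
  have hN1 : ((⌈|σ|⌉₊ : ℕ) : ℝ) ≤ |σ| + 1 := (Nat.ceil_lt_add_one (abs_nonneg σ)).le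
  have hN0 : (0 : ℝ) ≤ ((⌈|σ|⌉₊ : ℕ) : ℝ) := Nat.cast_nonneg _
  have hMN : (|c| + 2 / |c| + 2) ^ ⌈|σ|⌉₊ = Real.exp (⌈|σ|⌉₊ * L) := by
    rw [← Real.rpow_natCast, Real.rpow_def_of_pos (by positivity), hL, mul_comm]
  have hpack := exponent_pack (K := K) (Q := Q) hN0 hN1 (hL ▸ hlogM) hε hδε
  rw [← hC] at hpack
  calc ‖rsLineIntegral c (σ + τ * I)‖
      ≤ ‖-(1 + I : ℂ)‖ * ((|c| + 2 / |c| + 2) ^ ⌈|σ|⌉₊ * Real.exp (π * |τ|) / (2 * d) *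
          Real.exp ((min 1 ε * ⌈|σ|⌉₊) ^ 2 / (2 * π) + ⌈|σ|⌉₊ * K + Q)) := hstep
    _ = ‖-(1 + I : ℂ)‖ * (Real.exp (π * |τ|) / (2 * d) *
          Real.exp (⌈|σ|⌉₊ * L + ((min 1 ε * ⌈|σ|⌉₊) ^ 2 / (2 * π) + ⌈|σ|⌉₊ * K + Q))) := by
        rw [hMN, Real.exp_add (⌈|σ|⌉₊ * L)]; ring
    _ ≤ ‖-(1 + I : ℂ)‖ * (Real.exp (π * |τ|) / (2 * d) * Real.exp (ε * σ ^ 2 + C)) := by gcongr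
    _ = ‖-(1 + I : ℂ)‖ * (Real.exp (π * |τ|) / (2 * d) * Real.exp C) * Real.exp (ε * σ ^ 2) := by
        rw [Real.exp_add]; ring
    _ ≤ _ := by gcongr; linarith

/-- **Sub-Gaussian growth of the Riemann–Siegel line integral, uniformly on a horizontal strip**
`|Im s| ≤ τmax`: for `c > 0` not an integer and `ε > 0` there is `B` with
`|∫_{c↙} w^{-s} e^{iπw²}/(e^{iπw} − e^{−iπw}) dw| ≤ B e^{ε σ²}` for all `s = σ + iτ`, `|τ| ≤ τmax`
(the constant of `exists_norm_rsLineIntegral_line_le` depends on `τ` only through `e^{π|τ|}`).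
[cite: Polymath2019, §4, convergence of (37)] -/
theorem exists_norm_rsLineIntegral_strip_le {c : ℝ} (hc : 0 < c) (hcn : ∀ n : ℤ, (n : ℝ) ≠ c)
    (τmax : ℝ) {ε : ℝ} (hε : 0 < ε) :
    ∃ B : ℝ, 0 < B ∧ ∀ σ τ : ℝ, |τ| ≤ τmax →
      ‖rsLineIntegral c (σ + τ * I)‖ ≤ B * Real.exp (ε * σ ^ 2) := by
  obtain ⟨d, hd0, hd⟩ := exists_pos_le_abs_sub_int hcn
  have hπ : (0 : ℝ) < π := Real.pi_pos
  have hM1 : 1 ≤ |c| + 2 / |c| + 2 := by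
    have : 0 ≤ 2 / |c| := by positivity
    linarith [abs_nonneg c]
  have hlogM : 0 ≤ Real.log (|c| + 2 / |c| + 2) := Real.log_nonneg hM1
  have hδ0 : 0 < min 1 ε := lt_min one_pos hε
  have hδε : (min 1 ε) ^ 2 ≤ ε := by
    have h1 : min 1 ε ≤ 1 := min_le_left _ _
    have h2 : min 1 ε ≤ ε := min_le_right _ _
    nlinarith
  obtain ⟨L, hL⟩ : ∃ L : ℝ, L = Real.log (|c| + 2 / |c| + 2) := ⟨_, rfl⟩
  obtain ⟨K, hK⟩ : ∃ K : ℝ, K = min 1 ε - 1 - Real.log (min 1 ε) := ⟨_, rfl⟩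
  obtain ⟨Q, hQ⟩ : ∃ Q : ℝ, Q = (-2 * π * c) ^ 2 / (2 * π) := ⟨_, rfl⟩
  obtain ⟨C, hC⟩ : ∃ C : ℝ, C = (L + |K| + ε) ^ 2 / (4 * (ε / 2)) + L + |K| + ε + Q := ⟨_, rfl⟩
  refine ⟨‖-(1 + I : ℂ)‖ * (Real.exp (π * τmax) / (2 * d) * Real.exp C) + 1, by positivity,
    fun σ τ hτ ↦ ?_⟩
  have hstep := norm_rsLineIntegral_le_step hc hd0 hd hδ0 σ τ
  rw [← hK, ← hQ] at hstep
  have hN1 : ((⌈|σ|⌉₊ : ℕ) : ℝ) ≤ |σ| + 1 := (Nat.ceil_lt_add_one (abs_nonneg σ)).le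
  have hN0 : (0 : ℝ) ≤ ((⌈|σ|⌉₊ : ℕ) : ℝ) := Nat.cast_nonneg _
  have hMN : (|c| + 2 / |c| + 2) ^ ⌈|σ|⌉₊ = Real.exp (⌈|σ|⌉₊ * L) := by
    rw [← Real.rpow_natCast, Real.rpow_def_of_pos (by positivity), hL, mul_comm]
  have hpack := exponent_pack (K := K) (Q := Q) hN0 hN1 (hL ▸ hlogM) hε hδε
  rw [← hC] at hpack
  have hτ' : Real.exp (π * |τ|) ≤ Real.exp (π * τmax) := Real.exp_le_exp.2 (by nlinarith)
  calc ‖rsLineIntegral c (σ + τ * I)‖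
      ≤ ‖-(1 + I : ℂ)‖ * ((|c| + 2 / |c| + 2) ^ ⌈|σ|⌉₊ * Real.exp (π * |τ|) / (2 * d) *
          Real.exp ((min 1 ε * ⌈|σ|⌉₊) ^ 2 / (2 * π) + ⌈|σ|⌉₊ * K + Q)) := hstep
    _ ≤ ‖-(1 + I : ℂ)‖ * ((|c| + 2 / |c| + 2) ^ ⌈|σ|⌉₊ * Real.exp (π * τmax) / (2 * d) *
          Real.exp ((min 1 ε * ⌈|σ|⌉₊) ^ 2 / (2 * π) + ⌈|σ|⌉₊ * K + Q)) := by gcongr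
    _ = ‖-(1 + I : ℂ)‖ * (Real.exp (π * τmax) / (2 * d) *
          Real.exp (⌈|σ|⌉₊ * L + ((min 1 ε * ⌈|σ|⌉₊) ^ 2 / (2 * π) + ⌈|σ|⌉₊ * K + Q))) := by
        rw [hMN, Real.exp_add (⌈|σ|⌉₊ * L)]; ring
    _ ≤ ‖-(1 + I : ℂ)‖ * (Real.exp (π * τmax) / (2 * d) * Real.exp (ε * σ ^ 2 + C)) := by gcongr
    _ = ‖-(1 + I : ℂ)‖ * (Real.exp (π * τmax) / (2 * d) * Real.exp C) * Real.exp (ε * σ ^ 2) := by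
        rw [Real.exp_add]; ring
    _ ≤ _ := by gcongr; linarith

/-- Sub-Gaussian growth of `R_{0,N}` uniformly on a horizontal strip `0 < τ₀ ≤ Im s ≤ τ₁` is not
needed in this file; the strip version of the line-integral bound above is what the contour shift
of Prop. 6.3 consumes (the `ξ`-prefactor is handled there by the Taylor expansion of `log M₀`).
We record the specialisation `ε = 1/4`. [cite: Polymath2019, §4, convergence of (37)] -/
theorem exists_norm_rsLineIntegral_strip_le_quarter {c : ℝ} (hc : 0 < c)
    (hcn : ∀ n : ℤ, (n : ℝ) ≠ c) (τmax : ℝ) :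
    ∃ B : ℝ, 0 < B ∧ ∀ σ τ : ℝ, |τ| ≤ τmax →
      ‖rsLineIntegral c (σ + τ * I)‖ ≤ B * Real.exp (1 / 4 * σ ^ 2) :=
  exists_norm_rsLineIntegral_strip_le hc hcn τmax (by norm_num)

end Growth


/-! ## Integrability of the pieces on the line `Im s = Re z / 2` -/

section HeatLine

variable {t : ℝ}

/-- A sub-Gaussian bound `|F(σ + i Im s)| ≤ B e^{ε σ²}` with `ε t ≤ 1/4` makes
`v ↦ (1/√π) e^{−v²} F(s + √t v)` integrable. [cite: Polymath2019, §4 eq. (htz-expand)] -/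
theorem integrable_heat_of_growth {F : ℂ → ℂ} {s : ℂ} (ht : 0 < t)
    (hF : Continuous fun v : ℝ ↦ F (s + Real.sqrt t * v)) {B ε : ℝ} (hε0 : 0 ≤ ε)
    (hε : ε * t ≤ 1 / 4) (hB : ∀ σ : ℝ, ‖F (σ + s.im * I)‖ ≤ B * Real.exp (ε * σ ^ 2)) :
    Integrable fun v : ℝ ↦
      ((Real.exp (-v ^ 2) / Real.sqrt π : ℝ) : ℂ) * F (s + Real.sqrt t * v) := by
  have hmeas : Continuous fun v : ℝ ↦
      ((Real.exp (-v ^ 2) / Real.sqrt π : ℝ) : ℂ) * F (s + Real.sqrt t * v) :=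
    (Complex.continuous_ofReal.comp (by fun_prop)).mul hF
  refine Integrable.mono' ((integrable_exp_neg_mul_sq (by norm_num : (0:ℝ) < 1 / 2)).const_mul
    (|B| * Real.exp (2 * ε * s.re ^ 2) / Real.sqrt π)) hmeas.aestronglyMeasurable
    (Eventually.of_forall fun v ↦ ?_)
  rw [norm_mul, Complex.norm_real, Real.norm_of_nonneg (by positivity)]
  have hpt : s + Real.sqrt t * v = ((s.re + Real.sqrt t * v : ℝ) : ℂ) + s.im * I := by
    apply Complex.ext <;> simp
  have h1 := hB (s.re + Real.sqrt t * v)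
  rw [← hpt] at h1
  have h2 : ε * (s.re + Real.sqrt t * v) ^ 2 ≤ 2 * ε * s.re ^ 2 + v ^ 2 / 2 := by
    have ht' := Real.sq_sqrt ht.le
    have hsq : (s.re + Real.sqrt t * v) ^ 2 ≤ 2 * s.re ^ 2 + 2 * (t * v ^ 2) := by
      nlinarith [sq_nonneg (s.re - Real.sqrt t * v)]
    have h3 : ε * (2 * (t * v ^ 2)) ≤ v ^ 2 / 2 := by nlinarith [sq_nonneg v]
    nlinarith
  have h3 : ‖F (s + Real.sqrt t * v)‖ ≤ |B| * Real.exp (2 * ε * s.re ^ 2 + v ^ 2 / 2) :=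
    h1.trans (mul_le_mul (le_abs_self B) (Real.exp_le_exp.2 h2) (by positivity) (abs_nonneg B))
  have h4 : Real.exp (-v ^ 2) * Real.exp (2 * ε * s.re ^ 2 + v ^ 2 / 2)
      = Real.exp (2 * ε * s.re ^ 2) * Real.exp (-(1 / 2) * v ^ 2) := by
    rw [← Real.exp_add, ← Real.exp_add]; ring_nf
  calc Real.exp (-v ^ 2) / Real.sqrt π * ‖F (s + Real.sqrt t * v)‖
      ≤ Real.exp (-v ^ 2) / Real.sqrt π * (|B| * Real.exp (2 * ε * s.re ^ 2 + v ^ 2 / 2)) := by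
        gcongr
    _ = Real.exp (-v ^ 2) * Real.exp (2 * ε * s.re ^ 2 + v ^ 2 / 2) * |B| / Real.sqrt π := by
        ring
    _ = |B| * Real.exp (2 * ε * s.re ^ 2) / Real.sqrt π * Real.exp (-(1 / 2) * v ^ 2) := by
        rw [h4]; ring

/-- `r_{0,n}` is holomorphic off the real axis. [cite: Polymath2019, §4, after eq. (ron-def)] -/
theorem differentiableAt_r0_of_im_ne_zero (n : ℕ) {s : ℂ} (hs : s.im ≠ 0) :
    DifferentiableAt ℂ (r0 n) s := by
  have h2 : DifferentiableAt ℂ (fun z : ℂ ↦ (n : ℂ) ^ (-z)) s :=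
    (differentiableAt_id.neg).const_cpow (Or.inr fun h ↦ hs (by simpa using congrArg Complex.im h))
  exact (differentiableAt_xiFactor hs).mul h2

/-- `R_{0,N}` is holomorphic off the real axis. [cite: Polymath2019, §4, after eq. (ron-def)] -/
theorem differentiableAt_R0_of_im_ne_zero (N : ℕ) {s : ℂ} (hs : s.im ≠ 0) :
    DifferentiableAt ℂ (R0 N) s :=
  (differentiableAt_xiFactor hs).mul
    (differentiable_rsLineIntegral (c := N + 1 / 2) (by positivity) (int_ne_nat_add_half N) s)

/-- Continuity of a function holomorphic off the real axis along the heat line through `s`,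
`Im s ≠ 0`. [folklore] -/
private theorem continuous_line_of_differentiableAt {F : ℂ → ℂ}
    (hF : ∀ w : ℂ, w.im ≠ 0 → DifferentiableAt ℂ F w) {s : ℂ} (hs : s.im ≠ 0) (t : ℝ) :
    Continuous fun v : ℝ ↦ F (s + Real.sqrt t * v) := by
  have hline : Continuous fun v : ℝ ↦ s + Real.sqrt t * v := by fun_prop
  refine continuous_iff_continuousAt.2 fun v ↦ ?_
  have him : (s + Real.sqrt t * v).im ≠ 0 := by simpa using hs
  exact ContinuousAt.comp (g := F) (f := fun v : ℝ ↦ s + Real.sqrt t * v) (hF _ him).continuousAt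
    hline.continuousAt

/-- Sub-Gaussian growth of `r_{0,n}` on a horizontal line off the real axis.
[cite: Polymath2019, Lemma 5.1 (v)] -/
theorem exists_norm_r0_line_le {n : ℕ} (hn : 1 ≤ n) {τ : ℝ} (hτ : τ ≠ 0) {ε : ℝ} (hε : 0 < ε) :
    ∃ B : ℝ, 0 < B ∧ ∀ σ : ℝ, ‖r0 n (σ + τ * I)‖ ≤ B * Real.exp (ε * σ ^ 2) := by
  obtain ⟨B₁, hB₁, h₁⟩ := exists_norm_xiFactor_line_le hτ (half_pos hε)
  refine ⟨B₁ * Real.exp ((Real.log n) ^ 2 / (4 * (ε / 2))), by positivity, fun σ ↦ ?_⟩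
  have hn0 : 0 < n := hn
  rw [r0, norm_mul, Complex.norm_natCast_cpow_of_pos hn0]
  have hre : (-((σ : ℂ) + τ * I)).re = -σ := by simp
  rw [hre, Real.rpow_def_of_pos (by exact_mod_cast hn0)]
  have hlog : 0 ≤ Real.log n := Real.log_nonneg (by exact_mod_cast hn)
  have h2 : Real.log n * -σ ≤ ε / 2 * σ ^ 2 + (Real.log n) ^ 2 / (4 * (ε / 2)) := by
    have := mul_abs_le_sq (half_pos hε) (Real.log n) σ
    have h' : Real.log n * -σ ≤ Real.log n * |σ| := by
      have := neg_le_abs σ; nlinarith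
    linarith
  have h3 : Real.exp (ε * σ ^ 2) = Real.exp (ε / 2 * σ ^ 2) * Real.exp (ε / 2 * σ ^ 2) := by
    rw [← Real.exp_add]; ring_nf
  calc ‖xiFactor (σ + τ * I)‖ * Real.exp (Real.log n * -σ)
      ≤ B₁ * Real.exp (ε / 2 * σ ^ 2) *
          Real.exp (ε / 2 * σ ^ 2 + (Real.log n) ^ 2 / (4 * (ε / 2))) := by
        gcongr; exact h₁ σ
    _ = B₁ * Real.exp ((Real.log n) ^ 2 / (4 * (ε / 2))) * Real.exp (ε * σ ^ 2) := by
        rw [h3, Real.exp_add]; ring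

/-- Sub-Gaussian growth of `R_{0,N}` on a horizontal line off the real axis.
[cite: Polymath2019, Lemma 5.1 (v) and §4, convergence of (37)] -/
theorem exists_norm_R0_line_le (N : ℕ) {τ : ℝ} (hτ : τ ≠ 0) {ε : ℝ} (hε : 0 < ε) :
    ∃ B : ℝ, 0 < B ∧ ∀ σ : ℝ, ‖R0 N (σ + τ * I)‖ ≤ B * Real.exp (ε * σ ^ 2) := by
  obtain ⟨B₁, hB₁, h₁⟩ := exists_norm_xiFactor_line_le hτ (half_pos hε)
  obtain ⟨B₂, hB₂, h₂⟩ := exists_norm_rsLineIntegral_line_le (c := N + 1 / 2) (by positivity)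
    (int_ne_nat_add_half N) τ (half_pos hε)
  refine ⟨B₁ * B₂, by positivity, fun σ ↦ ?_⟩
  have h3 : Real.exp (ε * σ ^ 2) = Real.exp (ε / 2 * σ ^ 2) * Real.exp (ε / 2 * σ ^ 2) := by
    rw [← Real.exp_add]; ring_nf
  rw [R0, norm_mul]
  calc ‖xiFactor (σ + τ * I)‖ * ‖rsLineIntegral (N + 1 / 2) (σ + τ * I)‖
      ≤ B₁ * Real.exp (ε / 2 * σ ^ 2) * (B₂ * Real.exp (ε / 2 * σ ^ 2)) := by
        gcongr; exacts [h₁ σ, h₂ σ]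
    _ = B₁ * B₂ * Real.exp (ε * σ ^ 2) := by rw [h3]; ring

/-- `v ↦ (1/√π)e^{−v²} r_{0,n}(s + √t v)` is integrable for `t > 0`, `Im s ≠ 0`.
[cite: Polymath2019, §4 eq. (htz-expand)] -/
theorem integrable_heat_r0 (ht : 0 < t) {n : ℕ} (hn : 1 ≤ n) {s : ℂ} (hs : s.im ≠ 0) :
    Integrable fun v : ℝ ↦
      ((Real.exp (-v ^ 2) / Real.sqrt π : ℝ) : ℂ) * r0 n (s + Real.sqrt t * v) := by
  have hε : (0 : ℝ) < 1 / (4 * t) := by positivity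
  obtain ⟨B, -, hB⟩ := exists_norm_r0_line_le hn hs hε
  exact integrable_heat_of_growth ht
    (continuous_line_of_differentiableAt (fun w hw ↦ differentiableAt_r0_of_im_ne_zero n hw) hs t) hε.le
    (by field_simp; norm_num) hB

/-- `v ↦ (1/√π)e^{−v²} R_{0,N}(s + √t v)` is integrable for `t > 0`, `Im s ≠ 0`.
[cite: Polymath2019, §4 eq. (htz-expand)] -/
theorem integrable_heat_R0 (ht : 0 < t) (N : ℕ) {s : ℂ} (hs : s.im ≠ 0) :
    Integrable fun v : ℝ ↦
      ((Real.exp (-v ^ 2) / Real.sqrt π : ℝ) : ℂ) * R0 N (s + Real.sqrt t * v) := by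
  have hε : (0 : ℝ) < 1 / (4 * t) := by positivity
  obtain ⟨B, -, hB⟩ := exists_norm_R0_line_le N hs hε
  exact integrable_heat_of_growth ht
    (continuous_line_of_differentiableAt (fun w hw ↦ differentiableAt_R0_of_im_ne_zero N hw) hs t) hε.le
    (by field_simp; norm_num) hB

/-- Integrability of the reflected piece `v ↦ (1/√π)e^{−v²} F*(1 − s − √t v)` from that of the
direct piece at the reflected base point `conj(1 − s)`. [cite: Polymath2019, §4 eq. (htz-expand)] -/
theorem integrable_heat_refl {F : ℂ → ℂ} {s : ℂ}
    (h : Integrable fun v : ℝ ↦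
      ((Real.exp (-v ^ 2) / Real.sqrt π : ℝ) : ℂ) * F (conj (1 - s) + Real.sqrt t * v)) :
    Integrable fun v : ℝ ↦
      ((Real.exp (-v ^ 2) / Real.sqrt π : ℝ) : ℂ) * refl F (1 - (s + Real.sqrt t * v)) := by
  have h2 := Complex.conjCLE.toContinuousLinearMap.integrable_comp h.comp_neg
  refine h2.congr (Eventually.of_forall fun v ↦ ?_)
  simp only [ContinuousLinearEquiv.coe_coe, Complex.conjCLE_apply, map_mul, Complex.conj_ofReal,
    refl, map_sub, map_one, map_add]
  push_cast
  ring_nf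

/-- Integrability is preserved under pointwise sums of the pieces. [folklore] -/
private theorem integrable_heat_add {F G : ℂ → ℂ} {s : ℂ}
    (hF : Integrable fun v : ℝ ↦
      ((Real.exp (-v ^ 2) / Real.sqrt π : ℝ) : ℂ) * F (s + Real.sqrt t * v))
    (hG : Integrable fun v : ℝ ↦
      ((Real.exp (-v ^ 2) / Real.sqrt π : ℝ) : ℂ) * G (s + Real.sqrt t * v)) :
    Integrable fun v : ℝ ↦
      ((Real.exp (-v ^ 2) / Real.sqrt π : ℝ) : ℂ) * (F (s + Real.sqrt t * v) + G (s + Real.sqrt t * v)) := by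
  have := hF.add hG
  simpa only [Pi.add_def, mul_add] using this

/-- Integrability is preserved under finite sums of the pieces. [folklore] -/
private theorem integrable_heat_sum {ι : Type*} (S : Finset ι) {F : ι → ℂ → ℂ} {s : ℂ}
    (hF : ∀ i ∈ S, Integrable fun v : ℝ ↦
      ((Real.exp (-v ^ 2) / Real.sqrt π : ℝ) : ℂ) * F i (s + Real.sqrt t * v)) :
    Integrable fun v : ℝ ↦
      ((Real.exp (-v ^ 2) / Real.sqrt π : ℝ) : ℂ) * ∑ i ∈ S, F i (s + Real.sqrt t * v) := by
  simpa only [Finset.mul_sum] using integrable_finsetSum S hF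

end HeatLine

/-! ## The expansion (htz-expand) -/

/-- `H_t(z)` is the Gaussian average of `ξ/8` based at `s = (1+iz)/2` (eq. (htz)).
[cite: Polymath2019, §4 eq. (htz)] -/
theorem deBruijnH_eq_heatAvg {t : ℝ} (ht : 0 ≤ t) (z : ℂ) :
    deBruijnH t z = heatAvg t (fun w ↦ riemannXi w / 8) ((1 + I * z) / 2) := by
  rw [deBruijnH_eq_integral_riemannXi ht z, heatAvg, ← integral_const_mul]
  congr 1; ext v
  have hπ : (Real.sqrt π : ℂ) ≠ 0 := by
    exact_mod_cast (Real.sqrt_pos.2 Real.pi_pos).ne'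
  push_cast
  field_simp

/-- The `n`-th piece: `∫ (r_{0,n} + r*_{0,n}(1 − ·))(s + √t v)(1/√π)e^{−v²} dv = r_{t,n}(s) + r*_{t,n}(1−s)`.
[cite: Polymath2019, §4 eq. (htz-expand)] -/
theorem heatAvg_r0_piece {t : ℝ} (ht : 0 < t) {n : ℕ} (hn : 1 ≤ n) {s : ℂ} (hs : s.im ≠ 0) :
    heatAvg t (fun w ↦ r0 n w + refl (r0 n) (1 - w)) s = rt t n s + refl (rt t n) (1 - s) := by
  have hs' : (conj (1 - s)).im ≠ 0 := by simpa using hs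
  rw [heatAvg_add (G := fun w ↦ refl (r0 n) (1 - w)) (integrable_heat_r0 ht hn hs)
    (integrable_heat_refl (integrable_heat_r0 ht hn hs')), heatAvg_refl_one_sub]
  rfl

/-- The remainder piece: `∫ (R_{0,N} + R*_{0,N}(1 − ·))(s + √t v)(1/√π)e^{−v²} dv = R_{t,N}(s) + R*_{t,N}(1−s)`.
[cite: Polymath2019, §4 eq. (htz-expand)] -/
theorem heatAvg_R0_piece {t : ℝ} (ht : 0 < t) (N : ℕ) {s : ℂ} (hs : s.im ≠ 0) :
    heatAvg t (fun w ↦ R0 N w + refl (R0 N) (1 - w)) s = Rt t N s + refl (Rt t N) (1 - s) := by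
  have hs' : (conj (1 - s)).im ≠ 0 := by simpa using hs
  rw [heatAvg_add (G := fun w ↦ refl (R0 N) (1 - w)) (integrable_heat_R0 ht N hs)
    (integrable_heat_refl (integrable_heat_R0 ht N hs')), heatAvg_refl_one_sub]
  rfl

/-- Integrability of the `n`-th piece. [cite: Polymath2019, §4 eq. (htz-expand)] -/
private theorem integrable_r0_piece {t : ℝ} (ht : 0 < t) {n : ℕ} (hn : 1 ≤ n) {s : ℂ}
    (hs : s.im ≠ 0) : Integrable fun v : ℝ ↦ ((Real.exp (-v ^ 2) / Real.sqrt π : ℝ) : ℂ) *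
      (fun w ↦ r0 n w + refl (r0 n) (1 - w)) (s + Real.sqrt t * v) := by
  have hs' : (conj (1 - s)).im ≠ 0 := by simpa using hs
  exact integrable_heat_add (G := fun w ↦ refl (r0 n) (1 - w)) (integrable_heat_r0 ht hn hs)
    (integrable_heat_refl (integrable_heat_r0 ht hn hs'))

/-- Integrability of the remainder piece. [cite: Polymath2019, §4 eq. (htz-expand)] -/
private theorem integrable_R0_piece {t : ℝ} (ht : 0 < t) (N : ℕ) {s : ℂ}
    (hs : s.im ≠ 0) : Integrable fun v : ℝ ↦ ((Real.exp (-v ^ 2) / Real.sqrt π : ℝ) : ℂ) *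
      (fun w ↦ R0 N w + refl (R0 N) (1 - w)) (s + Real.sqrt t * v) := by
  have hs' : (conj (1 - s)).im ≠ 0 := by simpa using hs
  exact integrable_heat_add (G := fun w ↦ refl (R0 N) (1 - w)) (integrable_heat_R0 ht N hs)
    (integrable_heat_refl (integrable_heat_R0 ht N hs'))

/-- (htz-expand) at the level of the Gaussian average based at `s`, `Im s ≠ 0`.
[cite: Polymath2019, §4 eq. (htz-expand)] -/
theorem heatAvg_xi_expansion {t : ℝ} (ht : 0 < t) {s : ℂ} (hs : s.im ≠ 0) (N : ℕ) :
    heatAvg t (fun w ↦ riemannXi w / 8) s =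
      (∑ n ∈ Finset.Icc 1 N, (rt t n s + refl (rt t n) (1 - s))) +
        Rt t N s + refl (Rt t N) (1 - s) := by
  -- replace `ξ/8` by its Riemann–Siegel expansion on the line `Im w = Im s`
  have h2 : heatAvg t (fun w ↦ riemannXi w / 8) s = heatAvg t (fun w ↦
      (fun w ↦ ∑ n ∈ Finset.Icc 1 N, (fun n w ↦ r0 n w + refl (r0 n) (1 - w)) n w) w +
        (fun w ↦ R0 N w + refl (R0 N) (1 - w)) w) s := by
    refine heatAvg_congr_im fun w hw ↦ ?_
    simp only
    rw [riemannXi_div_eight_eq (by rw [hw]; exact hs), R0_zero_eq_sum_add N w,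
      refl_R0_zero_eq_sum_add N (1 - w), Finset.sum_add_distrib]
    ring
  have hIsum := integrable_heat_sum (t := t) (s := s) (Finset.Icc 1 N)
    (F := fun n w ↦ r0 n w + refl (r0 n) (1 - w))
    (fun n hn ↦ integrable_r0_piece ht (Finset.mem_Icc.1 hn).1 hs)
  have h3 : heatAvg t (fun w ↦
      (fun w ↦ ∑ n ∈ Finset.Icc 1 N, (fun n w ↦ r0 n w + refl (r0 n) (1 - w)) n w) w +
        (fun w ↦ R0 N w + refl (R0 N) (1 - w)) w) s
      = heatAvg t (fun w ↦ ∑ n ∈ Finset.Icc 1 N, (fun n w ↦ r0 n w + refl (r0 n) (1 - w)) n w) s +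
        heatAvg t (fun w ↦ R0 N w + refl (R0 N) (1 - w)) s :=
    heatAvg_add (F := fun w ↦ ∑ n ∈ Finset.Icc 1 N, (fun n w ↦ r0 n w + refl (r0 n) (1 - w)) n w)
      (G := fun w ↦ R0 N w + refl (R0 N) (1 - w)) hIsum (integrable_R0_piece ht N hs)
  have h4 : heatAvg t (fun w ↦ ∑ n ∈ Finset.Icc 1 N, (fun n w ↦ r0 n w + refl (r0 n) (1 - w)) n w) s
      = ∑ n ∈ Finset.Icc 1 N, heatAvg t ((fun n w ↦ r0 n w + refl (r0 n) (1 - w)) n) s :=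
    heatAvg_finset_sum (F := fun n w ↦ r0 n w + refl (r0 n) (1 - w)) (Finset.Icc 1 N)
      (fun n hn ↦ integrable_r0_piece ht (Finset.mem_Icc.1 hn).1 hs)
  have h5 : ∑ n ∈ Finset.Icc 1 N, heatAvg t ((fun n w ↦ r0 n w + refl (r0 n) (1 - w)) n) s
      = ∑ n ∈ Finset.Icc 1 N, (rt t n s + refl (rt t n) (1 - s)) :=
    Finset.sum_congr rfl fun n hn ↦ heatAvg_r0_piece ht (Finset.mem_Icc.1 hn).1 hs
  rw [h2, h3, h4, h5, heatAvg_R0_piece ht N hs, ← add_assoc]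

/-- **Polymath 15, eq. (htz-expand): the heat-flowed Riemann–Siegel expansion of `H_t`.** For
`t > 0`, `Re z ≠ 0` and every `N ≥ 0`,
`H_t(z) = Σ_{n=1}^N (r_{t,n}((1+iz)/2) + r*_{t,n}((1−iz)/2)) + R_{t,N}((1+iz)/2) + R*_{t,N}((1−iz)/2)`,
where `r_{t,n}`, `R_{t,N}` are the Gaussian averages `∫ F(s + √t v)(1/√π)e^{−v²} dv` of
`r_{0,n}(s) = (1/8)(s(s−1)/2)π^{−s/2}Γ(s/2) n^{−s}` and of the Riemann–Siegel remainder `R_{0,N}`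
(line through `N + 1/2`), and `F*(s) = conj F(conj s)`.  (Obtained from (htz) and the
Riemann–Siegel formula (37) for `ξ`, interchanging the finite sum with the absolutely convergent
Gaussian integral.) [cite: Polymath2019, §4 eq. (htz-expand)] -/
theorem heat_rs_expansion : ∀ t : ℝ, 0 < t → ∀ z : ℂ, z.re ≠ 0 → ∀ N : ℕ,
    deBruijnH t z =
      (∑ n ∈ Finset.Icc 1 N, (rt t n ((1 + I * z) / 2) + refl (rt t n) ((1 - I * z) / 2))) +
        Rt t N ((1 + I * z) / 2) + refl (Rt t N) ((1 - I * z) / 2) := by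
  intro t ht z hz N
  have hs1 : (1 - I * z) / 2 = 1 - (1 + I * z) / 2 := by ring
  have hsim : ((1 + I * z) / 2).im ≠ 0 := by
    have : ((1 + I * z) / 2).im = z.re / 2 := by simp [Complex.add_im]
    rw [this]
    exact div_ne_zero hz two_ne_zero
  rw [hs1, deBruijnH_eq_heatAvg ht.le z]
  exact heatAvg_xi_expansion ht hsim N

end Polymath15

end Literature.NumberTheory.LFunctions

end
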